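import Mathlib
import Summits.KontsevichZagierPeriods.Zeta5Search.WedgeDictionaryDescent22Closed
import Summits.KontsevichZagierPeriods.Zeta5Search.BaileyFromSorokinReflection
import Summits.KontsevichZagierPeriods.Zeta5Search.WedgeDictionaryClosing
import HarnessLib

/-!
# Brown–Zudilin (22) on the dictionary's box from ONE cited fact: Zudilin 2002 at `k = 3` (cell `pub-zeta5`, seat ct-1 g25)

HONEST FRAMING: systematic search; no irrationality claim unless certified.  CONDITIONAL results (hypothesis: the named Literature fact
`Zudilin2002.vwp_eq_integral_of_pos` — Zudilin's positive-parameter identity "very-well-poised series = Sorokin integral", used at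
`k = 3` only); identities between absolutely convergent integrals, very-well-poised series and the cell's rational dictionary data;
nothing about the arithmetic of `ζ(3)` or `ζ(5)`; no `γ`; records in print unmoved.  NOTHING IS DISCHARGED: the cited fact
`BrownZudilin2022.descent22` ((22) on ITS domain — `(p;q) ≥ 0`, residue range, provisos) stays a named fact; named-fact debt unchanged.

OUR work (Summit side).  gen-1 g10/g11 (`WedgeDictionaryDescent22{,Transport,Weak,Closed}`) read Brown–Zudilin's residue formula (22)
in the direction «(22) ∧ Zudilin 2002 ∧ Bailey ⟹ the `P̂`-third of the dictionary».  Since then the dictionary itself became a theorem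
(ct-1 g21's `explicitPQ_holds`), and Bailey's transformation became a consequence of Zudilin 2002 (ct-1 g25's
`baileyTransformClosed_of_vwp_eq_integral`, the reflection symmetry of `J₃`).  This file records the CONVERSE READING with its single
remaining cited input:

* `rhs22_eq_on_box_of_vwp` — GIVEN Zudilin 2002: on the dictionary's box (the hypotheses of g11's node `phatPartResidueLD`: region,
  level-descent box `2b_i ≤ b₀`, partner `j`, `p ≥ 0`, residue range `p₄ + q₄ ≤ p₃`, clause 2 of the level descent; its `q ≥ 0` is
  not needed) the displayed
  right-hand side of (22) is `rhs22(p;q) = 2·Q(a)·ζ(3) − 2ρ(a)(U(b)V(b′) − U(b′)V(b))` (g11's inline `key` identity of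
  `phatPartLD_of_descent22`, exported; it never used (22));
* `bz22_on_box_of_vwp` — GIVEN Zudilin 2002: on the same box the CONCLUSION of `descent22` holds verbatim,
  `∃ P ∈ ℚ, I(a) = 2(Q(a)ζ(5) − P) + 2ζ(2)·rhs22(p(a);q(a))`, with `P = ρ(W′V − WV′)` from `explicitPQ_holds`;
* `bz22_ones_of_vwp` — the instance at Brown–Zudilin's first example `a = (1,…,1)` (all nine hypotheses hold there, `decide`).
-/

noncomputable section

open Finset

namespace Summit.KontsevichZagierPeriods.Zeta5Search.Descent22OnBoxFromZudilin

open Summit.KontsevichZagierPeriods.Zeta5Search.DualSeries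
open Summit.KontsevichZagierPeriods.Zeta5Search.WedgeDictionary
open Summit.KontsevichZagierPeriods.Zeta5Search.WedgeDictionaryClosing (explicitPQ_holds)
open Summit.KontsevichZagierPeriods.Zeta5Search.BaileyFromSorokinReflection (baileyTransformClosed_of_vwp_eq_integral)
open Literature.NumberTheory.Irrationality.BrownZudilin2022
  (vwpDual hOfB bOfA pOf qOf Converges cellularIntegral QOf zchoose J3 w22 rhs22 J3TermsConverge descent22)
open Literature.NumberTheory.Irrationality.Zudilin2002 (vwp_eq_integral_of_pos)
open Literature.NumberTheory.Irrationality.Zudilin2004 (WeakAdmissible)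
open Literature.NumberTheory.Transcendental (zetaValue)

/-- **The right-hand side of (22) in closed form on the dictionary's box, GIVEN Zudilin 2002 (CONDITIONAL).**  Under the
hypotheses of `phatPartResidueLD` (all but its `q ≥ 0`, which is not needed), `rhs22(p(a);q(a)) = 2·Q(a)·ζ(3) − 2ρ(a)(U(b)V(b′) − U(b′)V(b))`, `b = b(a)`, `b′ = b + e_j`: each term of
(22) is `2ρ` times a term of the level descent (g11's `term22_eq_weak`, with the closed-cone Bailey invariance now SUPPLIED by
`baileyTransformClosed_of_vwp_eq_integral`), and the level descent (`levelDescentW_holds`, `levelDescentV_holds`) with the `Q`-half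
(`wedgeDictionary_Q`) sums them.  The proof is g11's `key`, verbatim up to the source of `hBc`.
[cite: BrownZudilin2022, Sect. 6, eq. (22)–(24); Zudilin2002VWPIntegrals, Theorem (eq. (4))] -/
theorem rhs22_eq_on_box_of_vwp (hZ : Literature.NumberTheory.Irrationality.Zudilin2002.vwp_eq_integral_of_pos)
    (a : Fin 8 → ℤ) (j : ℕ) (hj : j ∈ Icc 1 7) (hconv : Converges a)
    (hreg : ∀ i ∈ Icc 1 7, 0 ≤ bOfA a i ∧ 2 * bOfA a i ≤ bOfA a 0 + 1) (hd : 0 ≤ dOf (bOfA a))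
    (hpart : 2 * (bOfA a j + 1) ≤ bOfA a 0 + 1) (h2b : ∀ i ∈ Icc 1 7, 2 * bOfA a i ≤ bOfA a 0)
    (hp : ∀ i, 0 ≤ pOf a i) (hres : pOf a 4 + qOf a 3 ≤ pOf a 3)
    (hcl2 : bOfA a 0 - bOfA a 1 - bOfA a 2 ≤ dOf (bOfA a) + max 0 (max (bOfA a 7 - bOfA a 1) (bOfA a 7 - bOfA a 2))) :
    rhs22 (pOf a) (qOf a) = 2 * ((QOf a : ℚ) : ℝ) * zetaValue 3 -
      2 * ((rhoOf a * (coeffU (bOfA a) * coeffV (Function.update (bOfA a) j (bOfA a j + 1)) -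
              coeffU (Function.update (bOfA a) j (bOfA a j + 1)) * coeffV (bOfA a)) : ℚ) : ℝ) := by
  have hBc := baileyTransformClosed_of_vwp_eq_integral hZ
  have hJ : J3TermsConverge (pOf a) (qOf a) := j3TermsConverge_of_converges a hconv hres
  have hterms : ∀ k ∈ Icc (pOf a 4) (pOf a 4 + qOf a 3), pOf a 5 ≤ k → pOf a 6 ≤ k → WeakAdmissible (bFive a k) :=
    fun k hk h5 h6 => weakAdmissible_bFive a k hreg h2b hcl2 hk h5 h6 hres
  have e71 : bOfA a 7 - bOfA a 1 = pOf a 6 - pOf a 4 := by simp [bOfA, pOf]; ring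
  have e72 : bOfA a 7 - bOfA a 2 = pOf a 5 - pOf a 4 := by simp [bOfA, pOf]; ring
  have e12 : bOfA a 0 - bOfA a 1 - bOfA a 2 = qOf a 3 := by simp [bOfA, qOf]
  have e7 : bOfA a 7 = pOf a 3 - pOf a 4 := by simp [bOfA, pOf]; ring
  have hIn : InBox (bOfA a) := inBox_of_region (bOfA a) hreg hj hpart
  have hc12 : bOfA a 0 - bOfA a 1 - bOfA a 2 ≤ bOfA a 7 := by rw [e12, e7]; linarith
  have hmin : min (bOfA a 0 - bOfA a 1 - bOfA a 2) (bOfA a 7) = qOf a 3 := by rw [min_eq_left hc12, e12]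
  have hW := levelDescentW_holds (bOfA a) j hj hIn h2b hd hcl2
  have hV := levelDescentV_holds (bOfA a) j hj hIn h2b hd hc12 hcl2
  have hQ := wedgeDictionary_Q a j hj hconv hreg hd hpart
  rw [hmin] at hW hV
  rw [hW] at hQ
  rw [hQ, hV]
  set iLo := max 0 (max (bOfA a 7 - bOfA a 1) (bOfA a 7 - bOfA a 2)) with hi_def
  have hi' : iLo = max 0 (max (pOf a 6 - pOf a 4) (pOf a 5 - pOf a 4)) := by rw [hi_def, e71, e72]
  have hR : 2 * (((rhoOf a * ∑ i ∈ Icc iLo (qOf a 3), ldWeight (bOfA a) i * coeffW (degShape (bOfA a) i)) : ℚ) : ℝ) *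
        zetaValue 3 -
      2 * (((rhoOf a * ∑ i ∈ Icc iLo (qOf a 3), ldWeight (bOfA a) i * coeffV (degShape (bOfA a) i)) : ℚ) : ℝ) =
      ∑ i ∈ Icc iLo (qOf a 3), ((2 * rhoOf a * ldWeight (bOfA a) i : ℚ) : ℝ) *
        ((coeffW (degShape (bOfA a) i) : ℝ) * zetaValue 3 - coeffV (degShape (bOfA a) i)) := by
    push_cast
    rw [Finset.mul_sum, Finset.mul_sum, Finset.mul_sum, Finset.sum_mul, Finset.mul_sum, ← Finset.sum_sub_distrib]
    refine Finset.sum_congr rfl fun i _ => ?_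
    ring
  rw [hR]
  unfold rhs22
  have hsub : Icc (pOf a 4 + iLo) (pOf a 4 + qOf a 3) ⊆ Icc (pOf a 4) (pOf a 4 + qOf a 3) :=
    Icc_subset_Icc (by rw [hi']; omega) le_rfl
  rw [← Finset.sum_subset hsub]
  · rw [← Finset.map_add_left_Icc, Finset.sum_map]
    refine Finset.sum_congr rfl fun i hi => ?_
    have hi2 := mem_Icc.1 hi
    have hk : pOf a 4 + i ∈ Icc (pOf a 4) (pOf a 4 + qOf a 3) := mem_Icc.2 ⟨by rw [hi'] at hi2; omega, by omega⟩
    have h5 : pOf a 5 ≤ pOf a 4 + i := by rw [hi'] at hi2; omega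
    have h6 : pOf a 6 ≤ pOf a 4 + i := by rw [hi'] at hi2; omega
    have := term22_eq_weak hZ hBc a (pOf a 4 + i) hreg hp hk h5 h6 hJ (hterms _ hk h5 h6)
    simpa only [addLeftEmbedding_apply, add_sub_cancel_left] using this
  · intro k hk hk'
    have hk2 := mem_Icc.1 hk
    have hlt : k < pOf a 6 ∨ k < pOf a 5 := by
      rw [hi'] at hk'
      simp only [mem_Icc, not_and, not_le] at hk'
      by_contra hcon
      push Not at hcon
      have := hk' (by omega)
      omega
    have hw0 : w22 (pOf a) (qOf a) k = 0 := by
      unfold w22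
      rcases hlt with h | h
      · rw [show zchoose k (pOf a 6) = 0 by rw [zchoose, if_neg (by omega)]]; ring
      · rw [show zchoose (qOf a 4) (k - pOf a 5) = 0 by rw [zchoose, if_neg (by omega)]]; ring
    rw [hw0]; simp

/-- **Brown–Zudilin (22) on the dictionary's box, GIVEN Zudilin 2002 (CONDITIONAL; the conclusion of the cited `descent22` VERBATIM,
on a different domain — the hypotheses of `phatPartResidueLD` less `q ≥ 0`):**  `∃ P ∈ ℚ, I(a) = 2(Q(a)ζ(5) − P) + 2ζ(2)·rhs22(p(a);q(a))`,
with `P = ρ(a)(W(b′)V(b) − W(b)V(b′))` from the proved dictionary `explicitPQ_holds` and the closed form `rhs22_eq_on_box_of_vwp`.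
`descent22` itself (domain: `(p;q) ≥ 0`, residue range, provisos `J3TermsConverge`) is NOT discharged; named-fact debt unchanged.
[cite: BrownZudilin2022, Sect. 6, eq. (22) with (23), Sect. 1, eq. (4); Zudilin2002VWPIntegrals, Theorem (eq. (4))] -/
theorem bz22_on_box_of_vwp (hZ : Literature.NumberTheory.Irrationality.Zudilin2002.vwp_eq_integral_of_pos)
    (a : Fin 8 → ℤ) (j : ℕ) (hj : j ∈ Icc 1 7) (hconv : Converges a)
    (hreg : ∀ i ∈ Icc 1 7, 0 ≤ bOfA a i ∧ 2 * bOfA a i ≤ bOfA a 0 + 1) (hd : 0 ≤ dOf (bOfA a))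
    (hpart : 2 * (bOfA a j + 1) ≤ bOfA a 0 + 1) (h2b : ∀ i ∈ Icc 1 7, 2 * bOfA a i ≤ bOfA a 0)
    (hp : ∀ i, 0 ≤ pOf a i) (hres : pOf a 4 + qOf a 3 ≤ pOf a 3)
    (hcl2 : bOfA a 0 - bOfA a 1 - bOfA a 2 ≤ dOf (bOfA a) + max 0 (max (bOfA a 7 - bOfA a 1) (bOfA a 7 - bOfA a 2))) :
    ∃ P : ℚ, cellularIntegral a =
      2 * ((QOf a : ℝ) * zetaValue 5 - (P : ℝ)) + 2 * zetaValue 2 * rhs22 (pOf a) (qOf a) := by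
  refine ⟨rhoOf a * (coeffW (Function.update (bOfA a) j (bOfA a j + 1)) * coeffV (bOfA a) -
      coeffW (bOfA a) * coeffV (Function.update (bOfA a) j (bOfA a j + 1))), ?_⟩
  rw [rhs22_eq_on_box_of_vwp hZ a j hj hconv hreg hd hpart h2b hp hres hcl2,
    explicitPQ_holds a j hj hconv hreg hd hpart]
  push_cast
  ring

/-- **The instance at Brown–Zudilin's first example `a = (1,…,1)`, GIVEN Zudilin 2002 (CONDITIONAL):** with `j = 1` all nine hypotheses
hold (`decide`), so `∃ P ∈ ℚ, I(1,…,1) = 2(Q(1,…,1)ζ(5) − P) + 2ζ(2)·rhs22(p;q)` — (22) at the point where the source illustrates it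
(`Q₁ = 21`, `P₁ = 87/4`, `P̂₁ = 101/4`, Sect. 2; two terms `k = 1, 2`, the second on a face of the Bailey cone).
[cite: BrownZudilin2022, Sect. 2, eq. (5) and Sect. 6, eq. (22); Zudilin2002VWPIntegrals, Theorem (eq. (4))] -/
theorem bz22_ones_of_vwp (hZ : Literature.NumberTheory.Irrationality.Zudilin2002.vwp_eq_integral_of_pos) :
    ∃ P : ℚ, cellularIntegral (fun _ => 1) =
      2 * ((QOf (fun _ => 1) : ℝ) * zetaValue 5 - (P : ℝ)) +
        2 * zetaValue 2 * rhs22 (pOf (fun _ => 1)) (qOf (fun _ => 1)) :=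
  bz22_on_box_of_vwp hZ (fun _ => 1) 1 (by simp) (by decide) (by decide) (by decide) (by decide) (by decide) (by decide)
    (by decide) (by decide)

end Summit.KontsevichZagierPeriods.Zeta5Search.Descent22OnBoxFromZudilin
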